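import Summits.QuantumAdvantage.QuantumAdvantage.Theorems.SosSandwichPseudoBoundedAALevelTwoDecoupling
import Literature.Computability.QuantumComplexity.RazTalForrelation
import HarnessLib

/-!
# Route `SosSandwich`, crux `PseudoBoundedAA` (stmt-QuantumAdvantage-15237): level-`k` tools — sup norm of the
# level-`k` part and the Euler-type decoupling bound

Part 1 of the LEVEL-`k` RUNG of the AA ladder (the general bottom rung; part 2:
`Theorems/SosSandwichPseudoBoundedAALevelKRung.lean`; `k = 1, 2`: `…LevelOneRung.lean`, `…LevelTwoRung.lean`).
For an `M`-bounded function `g` on `{0,1}^N` of Fourier degree `≤ d` and `k ≥ 1`: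

* §1 `abs_levelK_sum_le` — **sup norm of the level-`k` part**: `|Σ_{|S|=k} ĝ(S) χ_S(s)| ≤ d^{2k-1}·M/k!` for every
  sign pattern `s` (the `k`-th coefficient of the noise polynomial `P_s`: Markov's inequality `k-1` times —
  `|P_s^{(j)}| ≤ d^{2j} M` on `[-1,1]` — then Bernstein's at the interior point `0`; tree `markov_inequality`,
  `bernstein_inequality`, Mathlib `Polynomial.coeff_iterate_derivative`).
* §2 `abs_weighted_sum_le` — **the Euler-type decoupling bound**: if `F = Σ_S c(S) χ_S` has `c(S) = 0` unless
  `|S| ≤ k` and `|F| ≤ L` on the cube, then `|Σ_S c(S) χ_S(u) |S ∩ J|| ≤ k²·L` for every `J ⊆ [N]` and `u`: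
  the PARTIAL NOISE polynomial `λ ↦ Σ_S c(S) χ_S(u) λ^{|S∩J|}` is, for `λ ∈ [-1,1]`, an average of values of `F`
  (noise with flip probability `(1-λ)/2` on the coordinates in `J` only: tree `flipWeight`,
  `sum_flipWeight_mul_walsh`), hence `L`-bounded, of degree `≤ k`, and its derivative at `λ = 1` is the weighted
  sum (Markov at the endpoint `1`).  This is what decouples the row sums of the level-`k` part in part 2
  (`Σ_i σ_i ∂_i F(u) = 2 Σ_S c(S)χ_S(u)|S ∩ J| - k F(u)` with `J = {σ = u}`).

Honest label: support lemmas (tools for the general bottom rung); no stub, crux or summit is proved.  Sources: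
Korneichuk 1991 §3.5.4 (Markov, Bernstein); O'Donnell 2014 §2.4 (noise), §1.4.
-/

-- D-0017: single-conjunct summit ⇒ the duplicate `QuantumAdvantage.QuantumAdvantage` is mandated.
set_option linter.dupNamespace false

noncomputable section

namespace Summit.QuantumAdvantage.QuantumAdvantage.Theorems.SosSandwich.LevelKRung

open Finset
open Literature.Computability.QuantumComplexity
open Literature.Computability.Complexity.LowDegree (cubeFourierCoeff sum_cubeFourierCoeff_mul_walsh
  sum_walsh_mul_walsh_index IsLevelLE isLevelLE_walsh)
open Literature.Probability.RandomGraphs.LowDegree (sgn walsh sgn_true sgn_false walsh_empty)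
open Literature.Barriers.QuantumAdvantage (flipWeight flipWeight_nonneg sum_flipWeight sum_flipWeight_mul_walsh bxor)
open Summit.QuantumAdvantage.QuantumAdvantage.Theorems.SosSandwich.LevelOneRung
open Summit.QuantumAdvantage.QuantumAdvantage.Theorems.SosSandwich.LevelTwoRung (coeff_noisePoly)

variable {N : ℕ}

/-! ### §1 The `k`-th coefficient of the noise polynomial: `|Σ_{|S|=k} ĝ(S) χ_S(s)| ≤ d^{2k-1} M / k!` -/

/-- Iterated derivatives of the noise polynomial keep degree `≤ d`. [folklore] -/
theorem degree_iterate_derivative_noisePoly_le {d : ℕ} {g : (Fin N → Bool) → ℝ} (hdeg : IsLevelLE d g)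
    (s : Fin N → Bool) (j : ℕ) :
    (Polynomial.derivative^[j] (∑ S : Finset (Fin N),
        Polynomial.C (cubeFourierCoeff g S * walsh S s) * Polynomial.X ^ S.card)).degree ≤ (d : WithBot ℕ) := by
  induction j with
  | zero => simpa using degree_noisePoly_le hdeg s
  | succ j ih =>
    rw [Function.iterate_succ_apply']
    exact Polynomial.degree_derivative_le.trans ih

/-- **Markov iterated**: `|P_s^{(j)}(y)| ≤ d^{2j}·M` on `[-1, 1]`. [cite: Korneichuk1991, Thm 3.5.8 (§3.5.4)] -/
theorem abs_eval_iterate_derivative_noisePoly_le {d : ℕ} {M : ℝ} {g : (Fin N → Bool) → ℝ} (hdeg : IsLevelLE d g)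
    (hM : ∀ x, |g x| ≤ M) (s : Fin N → Bool) (j : ℕ) {y : ℝ} (hy : y ∈ Set.Icc (-1 : ℝ) 1) :
    |(Polynomial.derivative^[j] (∑ S : Finset (Fin N),
        Polynomial.C (cubeFourierCoeff g S * walsh S s) * Polynomial.X ^ S.card)).eval y| ≤
      (d : ℝ) ^ (2 * j) * M := by
  induction j generalizing y with
  | zero => simpa using abs_eval_noisePoly_le hM s hy
  | succ j ih =>
    rw [Function.iterate_succ_apply']
    have h := Literature.Analysis.Approximation.markov_inequality
      (degree_iterate_derivative_noisePoly_le hdeg s j) (fun _ hz => ih hz) hy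
    calc _ ≤ (d : ℝ) ^ 2 * ((d : ℝ) ^ (2 * j) * M) := h
      _ = (d : ℝ) ^ (2 * (j + 1)) * M := by
          rw [show 2 * (j + 1) = 2 * j + 2 by ring, pow_add]; ring

/-- The `k`-th derivative of the noise polynomial at `0` is `k!` times the level-`k` sum. [folklore] -/
theorem eval_zero_iterate_derivative_noisePoly (g : (Fin N → Bool) → ℝ) (s : Fin N → Bool) (k : ℕ) :
    (Polynomial.derivative^[k] (∑ S : Finset (Fin N),
        Polynomial.C (cubeFourierCoeff g S * walsh S s) * Polynomial.X ^ S.card)).eval 0 =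
      (k.factorial : ℝ) * ∑ S ∈ univ.filter (fun S : Finset (Fin N) => S.card = k),
        cubeFourierCoeff g S * walsh S s := by
  rw [← Polynomial.coeff_zero_eq_eval_zero, Polynomial.coeff_iterate_derivative, zero_add,
    Nat.descFactorial_self, nsmul_eq_mul, coeff_noisePoly]

/-- **Sup norm of the level-`k` part** (`k ≥ 1`): `|Σ_{|S|=k} ĝ(S) χ_S(s)| ≤ d^{2k-1}·M/k!` for an `M`-bounded `g`
of Fourier degree `≤ d` and every sign pattern `s` (Bernstein at `0` for `P_s^{(k-1)}`, which is `d^{2k-2}M`-bounded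
by Markov). [cite: Korneichuk1991, Prop 3.5.7 and Thm 3.5.8 (§3.5.4)] [cite: ODonnell2014, §2.4] -/
theorem abs_levelK_sum_le {d : ℕ} {M : ℝ} {g : (Fin N → Bool) → ℝ} (hdeg : IsLevelLE d g)
    (hM : ∀ x, |g x| ≤ M) {k : ℕ} (hk : 1 ≤ k) (s : Fin N → Bool) :
    |∑ S ∈ univ.filter (fun S : Finset (Fin N) => S.card = k), cubeFourierCoeff g S * walsh S s|
      ≤ (d : ℝ) ^ (2 * k - 1) * M / k.factorial := by
  obtain ⟨j, rfl⟩ : ∃ j, k = j + 1 := ⟨k - 1, by omega⟩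
  have hB := Literature.Analysis.Approximation.bernstein_inequality
    (degree_iterate_derivative_noisePoly_le hdeg s j)
    (fun _ hz => abs_eval_iterate_derivative_noisePoly_le hdeg hM s j hz) (x := 0) ⟨by norm_num, by norm_num⟩
  rw [← Function.iterate_succ_apply' Polynomial.derivative j, eval_zero_iterate_derivative_noisePoly] at hB
  have hfac : (0 : ℝ) < ((j + 1).factorial : ℝ) := by positivity
  have hB' : ((j + 1).factorial : ℝ) *
      |∑ S ∈ univ.filter (fun S : Finset (Fin N) => S.card = j + 1), cubeFourierCoeff g S * walsh S s|
        ≤ d * ((d : ℝ) ^ (2 * j) * M) := by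
    have := hB
    simp only [ne_eq, OfNat.ofNat_ne_zero, not_false_eq_true, zero_pow, sub_zero, Real.sqrt_one,
      mul_one] at this
    rwa [abs_mul, abs_of_pos hfac] at this
  rw [le_div_iff₀ hfac]
  calc |∑ S ∈ univ.filter (fun S : Finset (Fin N) => S.card = j + 1), cubeFourierCoeff g S * walsh S s| *
        ((j + 1).factorial : ℝ)
      = ((j + 1).factorial : ℝ) *
          |∑ S ∈ univ.filter (fun S : Finset (Fin N) => S.card = j + 1), cubeFourierCoeff g S * walsh S s| :=
        mul_comm _ _
    _ ≤ d * ((d : ℝ) ^ (2 * j) * M) := hB'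
    _ = (d : ℝ) ^ (2 * (j + 1) - 1) * M := by
        rw [show 2 * (j + 1) - 1 = 2 * j + 1 by omega, pow_succ]; ring

/-! ### §2 Partial noise and the Euler-type decoupling bound -/

/-- A character at the point `u` flipped by `e` on the coordinates of `J` only:
`χ_S(u ⊕ e_J) = χ_S(u)·χ_{S ∩ J}(e)`. [cite: ODonnell2014, §3.3] -/
theorem walsh_piecewise_bxor (S J : Finset (Fin N)) (u e : Fin N → Bool) :
    walsh S (J.piecewise (bxor u e) u) = walsh S u * walsh (S.filter (· ∈ J)) e := by
  rw [Literature.Computability.Complexity.LowDegree.walsh_piecewise]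
  have h1 : ∏ i ∈ S.filter (· ∈ J), sgn (bxor u e i) =
      (∏ i ∈ S.filter (· ∈ J), sgn (u i)) * ∏ i ∈ S.filter (· ∈ J), sgn (e i) := by
    rw [← Finset.prod_mul_distrib]
    exact Finset.prod_congr rfl fun i _ => by
      unfold bxor; exact Literature.Computability.QuantumComplexity.sgn_xor _ _
  have h2 : (∏ i ∈ S.filter (· ∈ J), sgn (u i)) * walsh (S.filter (· ∉ J)) u = walsh S u := by
    unfold walsh
    exact Finset.prod_filter_mul_prod_filter_not S (· ∈ J) (fun i => sgn (u i))
  rw [h1]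
  unfold walsh at h2 ⊢
  calc (∏ i ∈ S.filter (· ∈ J), sgn (u i)) * (∏ i ∈ S.filter (· ∈ J), sgn (e i)) *
        ∏ i ∈ S.filter (· ∉ J), sgn (u i)
      = ((∏ i ∈ S.filter (· ∈ J), sgn (u i)) * ∏ i ∈ S.filter (· ∉ J), sgn (u i)) *
          ∏ i ∈ S.filter (· ∈ J), sgn (e i) := by ring
    _ = (∏ i ∈ S, sgn (u i)) * ∏ i ∈ S.filter (· ∈ J), sgn (e i) := by rw [h2]

/-- **Partial noise in the Walsh basis**: averaging `F = Σ_S c(S) χ_S` over flips of the `J`-coordinates with flip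
probability `η` multiplies `χ_S(u)` by `(1 - 2η)^{|S ∩ J|}` (`χ(a ⊕ b) = χ(a)χ(b)` is the tree's `sgn_xor`).
[cite: ODonnell2014, §2.4 and §3.3] -/
theorem partialNoise_eq (c : Finset (Fin N) → ℝ) (J : Finset (Fin N)) (u : Fin N → Bool) (η : ℝ) :
    ∑ e : Fin N → Bool, flipWeight η e * (∑ S : Finset (Fin N), c S * walsh S (J.piecewise (bxor u e) u)) =
      ∑ S : Finset (Fin N), c S * walsh S u * (1 - 2 * η) ^ (S.filter (· ∈ J)).card := by
  simp_rw [walsh_piecewise_bxor, Finset.mul_sum]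
  rw [Finset.sum_comm]
  refine Finset.sum_congr rfl fun S _ => ?_
  rw [← sum_flipWeight_mul_walsh η (S.filter (· ∈ J)), Finset.mul_sum]
  exact Finset.sum_congr rfl fun e _ => by ring

/-- A partially noised value is a convex combination of values: `|F| ≤ L` gives `|E_e F(u ⊕ e_J)| ≤ L` for
`0 ≤ η ≤ 1`. [cite: ODonnell2014, §2.4] -/
theorem abs_partialNoise_le {η L : ℝ} (h0 : 0 ≤ η) (h1 : η ≤ 1) {F : (Fin N → Bool) → ℝ}
    (hF : ∀ x, |F x| ≤ L) (J : Finset (Fin N)) (u : Fin N → Bool) :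
    |∑ e : Fin N → Bool, flipWeight η e * F (J.piecewise (bxor u e) u)| ≤ L := by
  calc |∑ e, flipWeight η e * F (J.piecewise (bxor u e) u)|
      ≤ ∑ e, |flipWeight η e * F (J.piecewise (bxor u e) u)| := Finset.abs_sum_le_sum_abs _ _
    _ ≤ ∑ e, flipWeight η e * L := Finset.sum_le_sum fun e _ => by
        rw [abs_mul, abs_of_nonneg (flipWeight_nonneg h0 h1 e)]
        exact mul_le_mul_of_nonneg_left (hF _) (flipWeight_nonneg h0 h1 e)
    _ = L := by rw [← Finset.sum_mul, sum_flipWeight, one_mul]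

/-- Evaluation of the partial-noise polynomial `Q(λ) = Σ_S c(S) χ_S(u) λ^{|S ∩ J|}`. [folklore] -/
theorem eval_partialNoisePoly (c : Finset (Fin N) → ℝ) (J : Finset (Fin N)) (u : Fin N → Bool) (t : ℝ) :
    (∑ S : Finset (Fin N), Polynomial.C (c S * walsh S u) * Polynomial.X ^ (S.filter (· ∈ J)).card).eval t =
      ∑ S : Finset (Fin N), c S * walsh S u * t ^ (S.filter (· ∈ J)).card := by
  rw [Polynomial.eval_finsetSum]
  exact Finset.sum_congr rfl fun S _ => by
    rw [Polynomial.eval_mul, Polynomial.eval_C, Polynomial.eval_pow, Polynomial.eval_X]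

/-- The partial-noise polynomial of an `L`-bounded `F = Σ_S c(S) χ_S` is `L`-bounded on `[-1, 1]`.
[cite: ODonnell2014, §2.4] -/
theorem abs_eval_partialNoisePoly_le {L : ℝ} (c : Finset (Fin N) → ℝ)
    (hF : ∀ x, |∑ S : Finset (Fin N), c S * walsh S x| ≤ L) (J : Finset (Fin N)) (u : Fin N → Bool)
    {t : ℝ} (ht : t ∈ Set.Icc (-1 : ℝ) 1) :
    |(∑ S : Finset (Fin N), Polynomial.C (c S * walsh S u) * Polynomial.X ^ (S.filter (· ∈ J)).card).eval t|
      ≤ L := by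
  rw [eval_partialNoisePoly]
  have h := abs_partialNoise_le (η := (1 - t) / 2) (by linarith [ht.2]) (by linarith [ht.1]) hF J u
  rw [partialNoise_eq] at h
  have e : (1 - 2 * ((1 - t) / 2)) = t := by ring
  rw [e] at h
  exact h

/-- The partial-noise polynomial of coefficients supported on `|S| ≤ k` has degree `≤ k`. [folklore] -/
theorem degree_partialNoisePoly_le {k : ℕ} (c : Finset (Fin N) → ℝ)
    (hc : ∀ S : Finset (Fin N), c S ≠ 0 → S.card ≤ k) (J : Finset (Fin N)) (u : Fin N → Bool) :
    (∑ S : Finset (Fin N), Polynomial.C (c S * walsh S u) * Polynomial.X ^ (S.filter (· ∈ J)).card).degree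
      ≤ (k : WithBot ℕ) := by
  refine (Polynomial.degree_sum_le _ _).trans (Finset.sup_le fun S _ => ?_)
  by_cases hS : c S = 0
  · rw [hS, zero_mul, map_zero, zero_mul, Polynomial.degree_zero]
    exact bot_le
  · refine (Polynomial.degree_C_mul_X_pow_le _ _).trans ?_
    exact_mod_cast (Finset.card_filter_le _ _).trans (hc S hS)

/-- The derivative of the partial-noise polynomial at `1` is the `|S ∩ J|`-weighted sum. [folklore] -/
theorem eval_one_derivative_partialNoisePoly (c : Finset (Fin N) → ℝ) (J : Finset (Fin N)) (u : Fin N → Bool) :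
    (Polynomial.derivative (∑ S : Finset (Fin N),
        Polynomial.C (c S * walsh S u) * Polynomial.X ^ (S.filter (· ∈ J)).card)).eval 1 =
      ∑ S : Finset (Fin N), c S * walsh S u * ((S.filter (· ∈ J)).card : ℝ) := by
  rw [map_sum, Polynomial.eval_finsetSum]
  refine Finset.sum_congr rfl fun S _ => ?_
  rw [Polynomial.derivative_C_mul_X_pow, Polynomial.eval_mul, Polynomial.eval_C, Polynomial.eval_pow,
    Polynomial.eval_X, one_pow, mul_one]

/-- **The Euler-type decoupling bound.**  If `F = Σ_S c(S) χ_S` has `c(S) = 0` unless `|S| ≤ k` and `|F| ≤ L` on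
the cube, then `|Σ_S c(S) χ_S(u) |S ∩ J|| ≤ k²·L` for every `J` and `u` (Markov at the endpoint `1` for the
partial-noise polynomial). [cite: Korneichuk1991, Thm 3.5.8 (§3.5.4)] [cite: ODonnell2014, §2.4] -/
theorem abs_weighted_sum_le {k : ℕ} {L : ℝ} (c : Finset (Fin N) → ℝ)
    (hc : ∀ S : Finset (Fin N), c S ≠ 0 → S.card ≤ k)
    (hF : ∀ x, |∑ S : Finset (Fin N), c S * walsh S x| ≤ L) (J : Finset (Fin N)) (u : Fin N → Bool) :
    |∑ S : Finset (Fin N), c S * walsh S u * ((S.filter (· ∈ J)).card : ℝ)| ≤ (k : ℝ) ^ 2 * L := by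
  have h := Literature.Analysis.Approximation.markov_inequality (degree_partialNoisePoly_le c hc J u)
    (fun _ ht => abs_eval_partialNoisePoly_le c hF J u ht) (x := 1) ⟨by norm_num, le_rfl⟩
  rwa [eval_one_derivative_partialNoisePoly] at h

end Summit.QuantumAdvantage.QuantumAdvantage.Theorems.SosSandwich.LevelKRung
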